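import Summits.BirchSwinnertonDyer.BirchSwinnertonDyer.Theses.SemiOrdinaryEisensteinDescent
import Summits.BirchSwinnertonDyer.BirchSwinnertonDyer.Theorems.SemiOrdinaryEisensteinDescentWildSplitEisensteinInclusionAtThreeValueAtOne
import Summits.BirchSwinnertonDyer.Rank1Residual.X11b.RouteR1LogOmega
import Summits.BirchSwinnertonDyer.Rank1Residual.X11b.AnticyclotomicEmbedding
import Literature.NumberTheory.EllipticCurves.UnrIntegersUnits
import HarnessLib

/-!
# Crux E `WildSplitEisensteinInclusionAtThree` (stmt-BirchSwinnertonDyer-20479): its RANK-ONE RESTRICTION `E′`,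
# the higher-analytic-rank corner E carries beyond `E′`, and `E′ ⟺ E_𝟙′` over the Kolyvagin inclusion + control
# (cell `pub/bsd-wall`, width seat `bsd-wall-soed-p1-w3` g2, `--supports 20479`, helper)

Route `SemiOrdinaryEisensteinDescent` (SOED). TYPING FACT recorded here (kernel-certified shapes, no new
definition, no named fact, no `sorry`): crux E (#2) quantifies over EVERY imaginary quadratic `K` Heegner
for `N(E)` — unlike the route's cruxes #3 `WildKolyvaginUpperAtThree`, #4 `WildSplitWaldspurgerAtThree`,
#5 `WildSplitControlAtThree`, whose binders carry the datum `(H, ι, P)`, `L(E^{(d_K)},1) ≠ 0`,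
`P = y_K` and `¬ IsOfFinAddOrder P`. So E also speaks at the Heegner fields `K` with
`L(E^{(d_K)},1) = 0`, where `r_an(E/K) ≥ 3`, `y_K` is torsion (Gross–Zagier), the BDP / Liu–Zhang–Zhang
value of the frame at the trivial character is `(const)·log_ω(y_K)² = 0`, and E's inclusion
`Ch_Λ(X_(∅,0))·R₀⟦T⟧ ⊆ (L) ⊆ (T)` forces `f(𝟙) = 0` for every generator `f` of `Ch_Λ` — infinite
`Γ`-coinvariants of `X_(∅,0)`: EXACTLY the Eisenstein-side input of Skinner's `p`-converse theorem
(Skinner, Ann. of Math. 191 (2020), §2.7: «`L_𝔭^S(f,1) = 0 ⟹ #X_𝔭(f,K,S) = ∞`», Prop. 2.7.1/(11)), a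
statement that is OPEN at an additive supercuspidal `3` and that the route's kernel
(`EisensteinKernelAtThree`, item 20485) NEVER uses: the kernel picks `K` by Friedberg–Hoffstein WITH
`L(E^{(d_K)},1) ≠ 0`. The route text's barrier line «HeegnerPointBarrier: outside — every cell item
carries `r_an(E) = 1` and `L(E^{(d_K)},1) ≠ 0`» is therefore not true of item #2 as typed (nor of UTD's
20395, whose binders E copies).

* §1 (any prime `p`, pure algebra in `R₀⟦T⟧`) `constantCoeff_eq_zero_of_map_mem_span` — vanishing transfer at
  `𝟙`: `ι(f) ∈ (L)`, `L(0) = 0 ⟹ f(0) = 0`; `constantCoeff_eq_zero_of_hasValueAt_sq_logOmega` — a value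
  `c·(log_ω P/d)²` at `𝟙` with `P` torsion is `0`; `span_map_eq_span_of_span_le_of_norm_le` — VALUE-FRAME unit
  detection in INEQUALITY form: `(L) ⊆ (ι f)`, `f(0) ≠ 0`, `‖f(0)‖ ≤ ‖L(0)‖ ⟹ (ι f) = (L)` (UTD's
  `UniversalToricDescentTwinSplit.span_singleton_eq_of_mem_of_norm_constantCoeff_eq` is the equality form;
  not imported, re-derived in five lines).
* §2 THE HIGHER-RANK CORNER OF E: `charGenerator_constantCoeff_eq_zero_of_crux` (E ⟹ at every instance with
  `L(𝟙) = 0`, every generator of `Ch_Λ(X_(∅,0))` vanishes at `𝟙`) and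
  `charGenerator_constantCoeff_eq_zero_of_crux_of_isOfFinAddOrder` (E ⟹ at a TORSION point `P ∈ E(K)` and any
  displayed value `L(𝟙) = c·(log_ω P/c(Dt))²`, the same) — Skinner's step, displayed; nothing asserted about
  the value formula.
* §3 THE RESTRICTED CRUX `E′` := E with crux #4's datum binders `(H) (ι) (P)`, `L(E^{(d_K)},1) ≠ 0`,
  `P = y_K`, `¬ IsOfFinAddOrder P` inserted VERBATIM (displayed as a conclusion shape, not a definition):
  `restricted_of_crux : E → E′`; `valueAtOneRestricted_of_restricted : E′ → E_𝟙′` (w3 g0's value-at-`𝟙`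
  residual, restricted likewise); and THE KERNEL RE-RUN `wAllExclAddWildRankOneSurj_of_valueAtOneRestricted` /
  `wAllExclAddWildRankOneSurj_of_restricted`: `PublishedInputsWildThree → E′ → WildKolyvaginUpperAtThree →
  WildSplitWaldspurgerAtThree → WildSplitControlAtThree → WildRankZeroTwistAtThree →
  WildRankOneSurjNonTowerAtThree → WAllExclAddWildRankOneSurj` (bed-p3 g1's proof verbatim, the Eisenstein step
  fed at the Friedberg–Hoffstein field where `hLt, hP, hnt` are in hand) — the certified sketch for a
  one-line pen ticket «#2 ↦ E′» whenever SOED is next edited (pen decision (P) 2026-08-27T23:31:21Z: not now).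
* §4 `restricted_of_kolyvaginInclusion_of_valueAtOneRestricted_of_control` — over {Kolyvagin's finiteness BY
  NAME, UTD's Kolyvagin-direction inclusion `AdditiveSplitIMCInclusionAtThree` (stmt-BirchSwinnertonDyer-20395)
  displayed VERBATIM, the shared control crux #5}: `E_𝟙′ ⟹ E′` (§1 unit detection at the generator the
  control count supplies, `f(𝟙) ≠ 0`); with §3, `restricted_iff_valueAtOneRestricted`: `E′ ⟺ E_𝟙′` over those
  hypotheses — the Λ-adic restricted inclusion is NOT stronger than its `T = 0` shadow once the Kolyvagin
  inclusion and bottom-layer control hold (answers the question left open in `…ValueAtOne.lean`: modulo UTD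
  20395 + control, `E_𝟙` has no engine that `E′` lacks, and conversely).

HONEST STATUS: no progress on E's ENGINE (walls W1–W3 of the leads' census stand for `E′` as for E); every
research input is an antecedent; the crux is NOT claimed false (E is the Eisenstein half of the BDP main
conjecture, expected at every Heegner `K`); BSD is not proved for any curve. Supports, does not close,
stmt-BirchSwinnertonDyer-20479.

References: [Skinner2020] §2.7 (arXiv:1405.7294 p. 12, «a simple consequence of `L_𝔭^S(f,1) = 0`» and
Prop. 11); [JetchevSkinnerWan2017] §7.4.1; [BertoliniDarmonPrasanna2013] Thm. 5.13 (value at the norm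
character); [Castella2018] Thm. 2.3, §5; [GrossZagier1986] Thm. I.(6.3); [FriedbergHoffstein1995] Thm. B;
[SerreLocalFields1979] Ch. IV §4 (units of `R₀`); [SilvermanAEC2009] IV.6.4 (log kills torsion).
-/

noncomputable section

open scoped Classical

set_option linter.dupNamespace false -- `Summit.BirchSwinnertonDyer.BirchSwinnertonDyer.Theorems.…` (summit = sub)
set_option autoImplicit false

namespace Summit.BirchSwinnertonDyer.BirchSwinnertonDyer.Theorems.WildSplitEisensteinInclusionAtThreeRankOneRestriction

open WeierstrassCurve NumberField IsDedekindDomain Field PowerSeries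
  Literature.NumberTheory.EllipticCurves
  Literature.NumberTheory.EllipticCurves.ModularForms
  Literature.NumberTheory.EllipticCurves.Rank1Residual
  Literature.NumberTheory.EllipticCurves.KrizLi2019
  Summit.BirchSwinnertonDyer.Rank1Residual
  Summit.BirchSwinnertonDyer.Rank1Residual.Additive
  Summit.BirchSwinnertonDyer.Rank1Residual.X11b
  Summit.BirchSwinnertonDyer.Rank1Residual.X11b.AcSelmer
  Summit.BirchSwinnertonDyer.Rank1Residual.X11b.Halves
  Summit.BirchSwinnertonDyer.BirchSwinnertonDyer.Theses.SemiOrdinaryEisensteinDescent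
  Summit.BirchSwinnertonDyer.BirchSwinnertonDyer.Theorems
  Summit.BirchSwinnertonDyer.BirchSwinnertonDyer.Theorems.WildSplitEisensteinInclusionAtThreeValueAtOne

/-! ### §1 Algebra in `R₀⟦T⟧` (any prime): vanishing transfer at `𝟙`, a torsion value, unit detection -/

section Algebra

variable (p : ℕ) [Fact p.Prime]

/-- **Vanishing transfer at `𝟙`.** If the image of `f ∈ Λ` in `R₀⟦T⟧` lies in `(L)` and `L(0) = 0` then
`f(0) = 0`: `‖f(0)‖ ≤ ‖L(0)‖ = 0` (`norm_constantCoeff_le_of_map_mem_span`). [folklore] -/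
theorem constantCoeff_eq_zero_of_map_mem_span {f : IwasawaAlgebra p} {L : UnrSeries p}
    (hfL : PowerSeries.map (toUnr p) f ∈ Ideal.span {L}) (hL0 : constantCoeff L = 0) :
    constantCoeff f = 0 := by
  have hle := norm_constantCoeff_le_of_map_mem_span p hfL
  rw [hL0, ZeroMemClass.coe_zero, norm_zero] at hle
  have h0 : ((constantCoeff f : ℤ_[p]) : ℚ_[p]) = 0 := norm_eq_zero.mp (le_antisymm hle (norm_nonneg _))
  exact PadicInt.coe_eq_zero.mp h0

/-- **A value `c·(log_ω P/d)²` at `𝟙` with `P` TORSION is zero**: `log_ω P = 0` exactly at torsion points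
(`X11b.R1.logOmega_eq_zero_iff`), so `L(0) = c·0 = 0` (`UnrSeries.eq_constantCoeff_of_hasValueAt_zero`). The
displayed value is the SHAPE of the BDP / Liu–Zhang–Zhang formula at the trivial character (crux #4's
conclusion with an arbitrary constant `c`); nothing is asserted about that formula.
[cite: SilvermanAEC2009, IV.6.4 and VII.6.3] -/
theorem constantCoeff_eq_zero_of_hasValueAt_sq_logOmega (W : WeierstrassCurve ℚ) [W.IsElliptic]
    [W.IsGloballyMinimal] {K : Type} [Field K] [NumberField K] (e : K →+* ℚ_[p])
    {P : (W.baseChange K).toAffine.Point} (hP : IsOfFinAddOrder P) (c : ℂ_[p]) (d : ℚ_[p]) {L : UnrSeries p}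
    (hval : L.HasValueAt 0 (c * (algebraMap ℚ_[p] ℂ_[p] (logOmega W p e P / d)) ^ 2)) :
    constantCoeff L = 0 := by
  have hlog : logOmega W p e P = 0 := (R1.logOmega_eq_zero_iff W p e P).mpr hP
  have h := UnrSeries.eq_constantCoeff_of_hasValueAt_zero hval
  rw [hlog, zero_div, map_zero, zero_pow two_ne_zero, mul_zero] at h
  exact_mod_cast h.symm

/-- **Value-frame unit detection, inequality form.** In `R₀⟦T⟧`: if `(L) ⊆ (ι f)` (the KOLYVAGIN-direction
inclusion at a principal ideal), `f(0) ≠ 0` and `‖f(0)‖ ≤ ‖L(0)‖` (the value-at-`𝟙` residual of the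
EISENSTEIN-direction inclusion), then `(ι f) = (L)`: writing `L = q·ι(f)`, `‖L(0)‖ = ‖q(0)‖·‖f(0)‖ ≤ ‖f(0)‖`,
so `‖q(0)‖ = 1`, `q(0) ∈ R₀ˣ` (`unrIntegers.isUnit_iff_norm_eq_one`) and `q ∈ R₀⟦T⟧ˣ`.
[cite: SerreLocalFields1979, Ch. IV §4, Prop. 16 (units of the valuation ring `R₀`)] -/
theorem span_map_eq_span_of_span_le_of_norm_le {f : IwasawaAlgebra p} {L : UnrSeries p}
    (hle : Ideal.span {L} ≤ Ideal.span {PowerSeries.map (toUnr p) f}) (hf0 : constantCoeff f ≠ 0)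
    (hnorm : ‖((constantCoeff f : ℤ_[p]) : ℚ_[p])‖ ≤ ‖((constantCoeff L : unrIntegers p) : ℂ_[p])‖) :
    Ideal.span {PowerSeries.map (toUnr p) f} = Ideal.span {L} := by
  have hmem : L ∈ Ideal.span {PowerSeries.map (toUnr p) f} := hle (Ideal.mem_span_singleton_self L)
  obtain ⟨q, hq⟩ := Ideal.mem_span_singleton'.mp hmem
  -- `‖f(0)‖` read in `ℂ_p`
  have hF : ((constantCoeff (PowerSeries.map (toUnr p) f) : unrIntegers p) : ℂ_[p]) =
      algebraMap ℚ_[p] ℂ_[p] ((constantCoeff f : ℤ_[p]) : ℚ_[p]) := by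
    rw [CongruenceLimit.constantCoeff_map_apply, coe_toUnr]
  have hFnorm : ‖((constantCoeff (PowerSeries.map (toUnr p) f) : unrIntegers p) : ℂ_[p])‖ =
      ‖((constantCoeff f : ℤ_[p]) : ℚ_[p])‖ := by rw [hF, norm_algebraMap']
  have hFpos : 0 < ‖((constantCoeff f : ℤ_[p]) : ℚ_[p])‖ :=
    norm_pos_iff.mpr fun h ↦ hf0 (PadicInt.coe_eq_zero.mp h)
  -- `L(0) = q(0)·f(0)`
  have hfac : ((constantCoeff L : unrIntegers p) : ℂ_[p]) =
      ((constantCoeff q : unrIntegers p) : ℂ_[p]) *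
        ((constantCoeff (PowerSeries.map (toUnr p) f) : unrIntegers p) : ℂ_[p]) := by
    rw [← hq, map_mul, Subring.coe_mul]
  have hq1 : ‖((constantCoeff q : unrIntegers p) : ℂ_[p])‖ = 1 := by
    refine le_antisymm (norm_coe_unrIntegers_le_one p _) ?_
    have h1 : ‖((constantCoeff f : ℤ_[p]) : ℚ_[p])‖ ≤
        ‖((constantCoeff q : unrIntegers p) : ℂ_[p])‖ * ‖((constantCoeff f : ℤ_[p]) : ℚ_[p])‖ := by
      calc ‖((constantCoeff f : ℤ_[p]) : ℚ_[p])‖ ≤ ‖((constantCoeff L : unrIntegers p) : ℂ_[p])‖ := hnorm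
        _ = ‖((constantCoeff q : unrIntegers p) : ℂ_[p])‖ * ‖((constantCoeff f : ℤ_[p]) : ℚ_[p])‖ := by
            rw [hfac, norm_mul, hFnorm]
    by_contra hlt
    have hlt' : ‖((constantCoeff q : unrIntegers p) : ℂ_[p])‖ < 1 := not_le.mp hlt
    have : ‖((constantCoeff q : unrIntegers p) : ℂ_[p])‖ * ‖((constantCoeff f : ℤ_[p]) : ℚ_[p])‖ <
        1 * ‖((constantCoeff f : ℤ_[p]) : ℚ_[p])‖ := mul_lt_mul_of_pos_right hlt' hFpos
    rw [one_mul] at this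
    exact absurd h1 (not_le.mpr this)
  have hqu : IsUnit q :=
    PowerSeries.isUnit_iff_constantCoeff.mpr ((unrIntegers.isUnit_iff_norm_eq_one _).mpr hq1)
  rw [← hq]
  exact Ideal.span_singleton_eq_span_singleton.mpr (associated_unit_mul_right _ _ hqu)

/-- **Corollary: the Eisenstein-direction inclusion at that frame.** [folklore] -/
theorem span_map_le_span_of_span_le_of_norm_le {f : IwasawaAlgebra p} {L : UnrSeries p}
    (hle : Ideal.span {L} ≤ Ideal.span {PowerSeries.map (toUnr p) f}) (hf0 : constantCoeff f ≠ 0)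
    (hnorm : ‖((constantCoeff f : ℤ_[p]) : ℚ_[p])‖ ≤ ‖((constantCoeff L : unrIntegers p) : ℂ_[p])‖) :
    Ideal.span {PowerSeries.map (toUnr p) f} ≤ Ideal.span {L} :=
  (span_map_eq_span_of_span_le_of_norm_le p hle hf0 hnorm).le

end Algebra

/-! ### §2 The higher-analytic-rank corner of crux E (what E asserts where `L(𝟙) = 0`) -/

/-- **E ⟹ at every instance with `L(𝟙) = 0`, every generator of `Ch_Λ(X_(∅,0))` vanishes at `𝟙`.** E's
binders and torsion guard VERBATIM, then `L(0) = 0 → ∀ f, Ch_Λ = (f) → f(0) = 0` — Skinner's «simple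
consequence» `Ch ⊆ (L) ⊆ (γ − 1) ⟹ #X/(γ−1)X = ∞`, read on the generator. Nothing here says WHEN `L(𝟙) = 0`
(in nature: at the Heegner fields with `y_K` torsion, by the BDP value formula — §1
`constantCoeff_eq_zero_of_hasValueAt_sq_logOmega`). [cite: Skinner2020, §2.7 (arXiv:1405.7294 p. 12) and Prop. 11] -/
theorem charGenerator_constantCoeff_eq_zero_of_crux (hE : WildSplitEisensteinInclusionAtThree) :
    ∀ (W : WeierstrassCurve ℚ) [W.IsElliptic] [W.IsGloballyMinimal] (N : ℕ) [NeZero N] (K : Type) [Field K] [NumberField K] (Dt : Literature.NumberTheory.EllipticCurves.ModularForms.ModularParametrizationData W N), Summit.BirchSwinnertonDyer.Rank1Residual.Additive.ClassO6 W 3 → W.HasSurjectiveModNGaloisRep 3 → W.analyticRank = 1 → W.conductorNorm ℤ = N → Literature.NumberTheory.EllipticCurves.IsImaginaryQuadratic K → Literature.NumberTheory.EllipticCurves.SatisfiesHeegnerHypothesis N K → ∀ (κ : Literature.NumberTheory.EllipticCurves.ZpExtension K 3), κ.IsAnticyclotomic → ∀ (γ : Field.absoluteGaloisGroup K) [Fact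 (κ.IsTopGenerator γ)] (𝔭 : IsDedekindDomain.HeightOneSpectrum (NumberField.RingOfIntegers K)), ((3 : ℕ) : NumberField.RingOfIntegers K) ∈ 𝔭.asIdeal → 𝔭.asIdeal.ramificationIdx (NumberField.RingOfIntegers ℚ) = 1 → 𝔭.asIdeal.inertiaDeg (NumberField.RingOfIntegers ℚ) = 1 → ∀ (𝔭' : IsDedekindDomain.HeightOneSpectrum (NumberField.RingOfIntegers K)), ((3 : ℕ) : NumberField.RingOfIntegers K) ∈ 𝔭'.asIdeal → 𝔭' ≠ 𝔭 → ∀ (ι' : PadicAlgCl 3 ≃+* ℂ), Summit.BirchSwinnertonDyer.BirchSwinnertonDyer.Theorems.SchneiderFree.BranchInducesPrime 3 ι' 𝔭 → ∀ (ΩK : ℂ) (Ωp : ℂ_[3]) (L : Literature.NumberTheory.EllipticCurves.UnrSeries 3), ΩK ≠ 0 → Ωp ≠ 0 → Literature.NumberTheory.EllipticCurves.IsBDPLFunction ι' 𝔭 κ γ Dt.f ΩK Ωp L → Module.IsTorsion (Literature.NumberTheory.EllipticCurves.IwasawaAlgebra 3) (Summit.BirchSwinnertonDyer.Rank1Residual.X11b.AcSelmer.XAc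 (W.baseChange K) 3 κ 𝔭' ∅ γ) → PowerSeries.constantCoeff L = 0 → ∀ (f : Literature.NumberTheory.EllipticCurves.IwasawaAlgebra 3), Summit.BirchSwinnertonDyer.Rank1Residual.X11b.AcSelmer.XAc.charIdeal (W.baseChange K) 3 κ 𝔭' ∅ γ = Ideal.span {f} → PowerSeries.constantCoeff f = 0 := by
  intro W _ _ N _ K _ _ Dt hO6 hsurj hr1 hN hK hH κ hκ γ _ 𝔭 h𝔭 he hf 𝔭' h𝔭' hne ι' hι ΩK Ωp L hΩK hΩp hL htor hL0 f hfI
  have hincl := hE W N K Dt hO6 hsurj hr1 hN hK hH κ hκ γ 𝔭 h𝔭 he hf 𝔭' h𝔭' hne ι' hι ΩK Ωp L hΩK hΩp hL htor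
  rw [hfI, CongruenceLimit.map_span_singleton_powerSeries] at hincl
  exact constantCoeff_eq_zero_of_map_mem_span 3 ((Ideal.span_singleton_le_iff_mem _).mp hincl) hL0

/-- **E at a TORSION point ⟹ every generator of `Ch_Λ(X_(∅,0))` vanishes at `𝟙`, given any displayed value
`L(𝟙) = c·(log_ω P/c(Dt))²`.** E's binders VERBATIM with a point `P ∈ E(K)` of FINITE order in place of the
non-torsion Heegner point of cruxes #3–#5 (the corner `L(E^{(d_K)},1) = 0`, `y_K` torsion by Gross–Zagier),
the torsion guard, and — displayed, for every constant `c ∈ ℂ₃` and every `e : K → ℚ₃` — the value shape of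
crux #4 `WildSplitWaldspurgerAtThree` / the BDP formula at the trivial character. Conclusion: `f(𝟙) = 0` for
every generator `f` (§1 + `charGenerator_constantCoeff_eq_zero_of_crux`): the Eisenstein-side input of the
`p`-converse, which the route's kernel never visits. Nothing is asserted about the value formula.
[cite: Skinner2020, §2.7 (arXiv:1405.7294 p. 12) and Prop. 11] [cite: BertoliniDarmonPrasanna2013, Thm. 5.13] -/
theorem charGenerator_constantCoeff_eq_zero_of_crux_of_isOfFinAddOrder (hE : WildSplitEisensteinInclusionAtThree) :
    ∀ (W : WeierstrassCurve ℚ) [W.IsElliptic] [W.IsGloballyMinimal] (N : ℕ) [NeZero N] (K : Type) [Field K] [NumberField K] (Dt : Literature.NumberTheory.EllipticCurves.ModularForms.ModularParametrizationData W N) (P : (W.baseChange K).toAffine.Point), Summit.BirchSwinnertonDyer.Rank1Residual.Additive.ClassO6 W 3 → W.HasSurjectiveModNGaloisRep 3 → W.analyticRank = 1 → W.conductorNorm ℤ = N → Literature.NumberTheory.EllipticCurves.IsImaginaryQuadratic K → Literature.NumberTheory.EllipticCurves.SatisfiesHeegnerHypothesis N K → IsOfFinAddOrder P → ∀ (κ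 : Literature.NumberTheory.EllipticCurves.ZpExtension K 3), κ.IsAnticyclotomic → ∀ (γ : Field.absoluteGaloisGroup K) [Fact (κ.IsTopGenerator γ)] (𝔭 : IsDedekindDomain.HeightOneSpectrum (NumberField.RingOfIntegers K)), ((3 : ℕ) : NumberField.RingOfIntegers K) ∈ 𝔭.asIdeal → 𝔭.asIdeal.ramificationIdx (NumberField.RingOfIntegers ℚ) = 1 → 𝔭.asIdeal.inertiaDeg (NumberField.RingOfIntegers ℚ) = 1 → ∀ (𝔭' : IsDedekindDomain.HeightOneSpectrum (NumberField.RingOfIntegers K)), ((3 : ℕ) : NumberField.RingOfIntegers K) ∈ 𝔭'.asIdeal → 𝔭' ≠ 𝔭 → ∀ (ι' : PadicAlgCl 3 ≃+* ℂ), Summit.BirchSwinnertonDyer.BirchSwinnertonDyer.Theorems.SchneiderFree.BranchInducesPrime 3 ι' 𝔭 → ∀ (ΩK : ℂ) (Ωp : ℂ_[3]) (L : Literature.NumberTheory.EllipticCurves.UnrSeries 3), ΩK ≠ 0 → Ωp ≠ 0 → Literature.NumberTheory.EllipticCurves.IsBDPLFunction ι' 𝔭 κ γ Dt.f ΩK Ωp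 L → Module.IsTorsion (Literature.NumberTheory.EllipticCurves.IwasawaAlgebra 3) (Summit.BirchSwinnertonDyer.Rank1Residual.X11b.AcSelmer.XAc (W.baseChange K) 3 κ 𝔭' ∅ γ) → ∀ (c : ℂ_[3]) (e : K →+* ℚ_[3]), L.HasValueAt 0 (c * (algebraMap ℚ_[3] ℂ_[3] (Summit.BirchSwinnertonDyer.Rank1Residual.X11b.Halves.logOmega W 3 e P / (Dt.c : ℚ_[3]))) ^ 2) → ∀ (f : Literature.NumberTheory.EllipticCurves.IwasawaAlgebra 3), Summit.BirchSwinnertonDyer.Rank1Residual.X11b.AcSelmer.XAc.charIdeal (W.baseChange K) 3 κ 𝔭' ∅ γ = Ideal.span {f} → PowerSeries.constantCoeff f = 0 := by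
  intro W _ _ N _ K _ _ Dt P hO6 hsurj hr1 hN hK hH hPt κ hκ γ _ 𝔭 h𝔭 he hf 𝔭' h𝔭' hne ι' hι ΩK Ωp L hΩK hΩp hL
    htor c e hval f hfI
  exact charGenerator_constantCoeff_eq_zero_of_crux hE W N K Dt hO6 hsurj hr1 hN hK hH κ hκ γ 𝔭 h𝔭 he hf 𝔭' h𝔭' hne ι' hι ΩK Ωp L hΩK hΩp hL htor
    (constantCoeff_eq_zero_of_hasValueAt_sq_logOmega 3 W e hPt c (Dt.c : ℚ_[3]) hval) f hfI

/-! ### §3 The restricted crux `E′` (rank-one datum binders of crux #4 inserted) and the kernel from `E′` -/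

/-- **E ⟹ E′** (the restricted crux: E's text with crux #4's datum binders `(H) (ι) (P)`,
`L(E^{(d_K)},1) ≠ 0`, `P = y_K`, `¬ IsOfFinAddOrder P` inserted verbatim; the extra binders are simply not
used). `E′` is a displayed conclusion shape, not a definition or an item. [folklore] -/
theorem restricted_of_crux (hE : WildSplitEisensteinInclusionAtThree) :
    ∀ (W : WeierstrassCurve ℚ) [W.IsElliptic] [W.IsGloballyMinimal] (N : ℕ) [NeZero N] (K : Type) [Field K] [NumberField K] (Dt : Literature.NumberTheory.EllipticCurves.ModularForms.ModularParametrizationData W N) (H : Literature.NumberTheory.EllipticCurves.HeegnerDatum N (NumberField.discr K)) (ι : K →+* ℂ) (P : (W.baseChange K).toAffine.Point), Summit.BirchSwinnertonDyer.Rank1Residual.Additive.ClassO6 W 3 → W.HasSurjectiveModNGaloisRep 3 → W.analyticRank = 1 → W.conductorNorm ℤ = N → Literature.NumberTheory.EllipticCurves.IsImaginaryQuadratic K → Literature.NumberTheory.EllipticCurves.SatisfiesHeegnerHypothesis N K → (W.quadraticTwist (NumberField.discr K : ℚ)).entireLFunction 1 ≠ 0 → (WeierstrassCurve.Affine.Point.map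 ι.toRatAlgHom) P = Literature.NumberTheory.EllipticCurves.ModularForms.heegnerPointComplex Dt H → ¬ IsOfFinAddOrder P → ∀ (κ : Literature.NumberTheory.EllipticCurves.ZpExtension K 3), κ.IsAnticyclotomic → ∀ (γ : Field.absoluteGaloisGroup K) [Fact (κ.IsTopGenerator γ)] (𝔭 : IsDedekindDomain.HeightOneSpectrum (NumberField.RingOfIntegers K)), ((3 : ℕ) : NumberField.RingOfIntegers K) ∈ 𝔭.asIdeal → 𝔭.asIdeal.ramificationIdx (NumberField.RingOfIntegers ℚ) = 1 → 𝔭.asIdeal.inertiaDeg (NumberField.RingOfIntegers ℚ) = 1 → ∀ (𝔭' : IsDedekindDomain.HeightOneSpectrum (NumberField.RingOfIntegers K)), ((3 : ℕ) : NumberField.RingOfIntegers K) ∈ 𝔭'.asIdeal → 𝔭' ≠ 𝔭 → ∀ (ι' : PadicAlgCl 3 ≃+* ℂ), Summit.BirchSwinnertonDyer.BirchSwinnertonDyer.Theorems.SchneiderFree.BranchInducesPrime 3 ι' 𝔭 → ∀ (ΩK : ℂ) (Ωp : ℂ_[3]) (L : Literature.NumberTheory.EllipticCurves.UnrSeries 3),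 ΩK ≠ 0 → Ωp ≠ 0 → Literature.NumberTheory.EllipticCurves.IsBDPLFunction ι' 𝔭 κ γ Dt.f ΩK Ωp L → Module.IsTorsion (Literature.NumberTheory.EllipticCurves.IwasawaAlgebra 3) (Summit.BirchSwinnertonDyer.Rank1Residual.X11b.AcSelmer.XAc (W.baseChange K) 3 κ 𝔭' ∅ γ) → (Summit.BirchSwinnertonDyer.Rank1Residual.X11b.AcSelmer.XAc.charIdeal (W.baseChange K) 3 κ 𝔭' ∅ γ).map (PowerSeries.map (Summit.BirchSwinnertonDyer.Rank1Residual.X11b.Halves.toUnr 3)) ≤ Ideal.span {L} := by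
  intro W _ _ N _ K _ _ Dt H ι P hO6 hsurj hr1 hN hK hH hLt hP hnt κ hκ γ _ 𝔭 h𝔭 he hf 𝔭' h𝔭' hne ι' hι ΩK Ωp L hΩK hΩp hL htor
  exact hE W N K Dt hO6 hsurj hr1 hN hK hH κ hκ γ 𝔭 h𝔭 he hf 𝔭' h𝔭' hne ι' hι ΩK Ωp L hΩK hΩp hL htor

/-- **E′ ⟹ E_𝟙′**: the restricted crux read at the trivial character only — for every generator `f` of
`Ch_Λ(X_(∅,0))`, `‖f(𝟙)‖₃ ≤ ‖L(𝟙)‖` (`norm_constantCoeff_le_of_map_mem_span`, w3 g0), under the restricted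
binders. [cite: JetchevSkinnerWan2017, §7.4.1 (arXiv:1512.06894 p. 30)] -/
theorem valueAtOneRestricted_of_restricted
    (hE' : ∀ (W : WeierstrassCurve ℚ) [W.IsElliptic] [W.IsGloballyMinimal] (N : ℕ) [NeZero N] (K : Type) [Field K] [NumberField K] (Dt : Literature.NumberTheory.EllipticCurves.ModularForms.ModularParametrizationData W N) (H : Literature.NumberTheory.EllipticCurves.HeegnerDatum N (NumberField.discr K)) (ι : K →+* ℂ) (P : (W.baseChange K).toAffine.Point), Summit.BirchSwinnertonDyer.Rank1Residual.Additive.ClassO6 W 3 → W.HasSurjectiveModNGaloisRep 3 → W.analyticRank = 1 → W.conductorNorm ℤ = N → Literature.NumberTheory.EllipticCurves.IsImaginaryQuadratic K → Literature.NumberTheory.EllipticCurves.SatisfiesHeegnerHypothesis N K → (W.quadraticTwist (NumberField.discr K : ℚ)).entireLFunction 1 ≠ 0 → (WeierstrassCurve.Affine.Point.map ι.toRatAlgHom) P = Literature.NumberTheory.EllipticCurves.ModularForms.heegnerPointComplex Dt H → ¬ IsOfFinAddOrder P → ∀ (κ : Literature.NumberTheory.EllipticCurves.ZpExtension K 3),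 κ.IsAnticyclotomic → ∀ (γ : Field.absoluteGaloisGroup K) [Fact (κ.IsTopGenerator γ)] (𝔭 : IsDedekindDomain.HeightOneSpectrum (NumberField.RingOfIntegers K)), ((3 : ℕ) : NumberField.RingOfIntegers K) ∈ 𝔭.asIdeal → 𝔭.asIdeal.ramificationIdx (NumberField.RingOfIntegers ℚ) = 1 → 𝔭.asIdeal.inertiaDeg (NumberField.RingOfIntegers ℚ) = 1 → ∀ (𝔭' : IsDedekindDomain.HeightOneSpectrum (NumberField.RingOfIntegers K)), ((3 : ℕ) : NumberField.RingOfIntegers K) ∈ 𝔭'.asIdeal → 𝔭' ≠ 𝔭 → ∀ (ι' : PadicAlgCl 3 ≃+* ℂ), Summit.BirchSwinnertonDyer.BirchSwinnertonDyer.Theorems.SchneiderFree.BranchInducesPrime 3 ι' 𝔭 → ∀ (ΩK : ℂ) (Ωp : ℂ_[3]) (L : Literature.NumberTheory.EllipticCurves.UnrSeries 3), ΩK ≠ 0 → Ωp ≠ 0 → Literature.NumberTheory.EllipticCurves.IsBDPLFunction ι' 𝔭 κ γ Dt.f ΩK Ωp L → Module.IsTorsion (Literature.NumberTheory.EllipticCurves.IwasawaAlgebra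 3) (Summit.BirchSwinnertonDyer.Rank1Residual.X11b.AcSelmer.XAc (W.baseChange K) 3 κ 𝔭' ∅ γ) → (Summit.BirchSwinnertonDyer.Rank1Residual.X11b.AcSelmer.XAc.charIdeal (W.baseChange K) 3 κ 𝔭' ∅ γ).map (PowerSeries.map (Summit.BirchSwinnertonDyer.Rank1Residual.X11b.Halves.toUnr 3)) ≤ Ideal.span {L}) :
    ∀ (W : WeierstrassCurve ℚ) [W.IsElliptic] [W.IsGloballyMinimal] (N : ℕ) [NeZero N] (K : Type) [Field K] [NumberField K] (Dt : Literature.NumberTheory.EllipticCurves.ModularForms.ModularParametrizationData W N) (H : Literature.NumberTheory.EllipticCurves.HeegnerDatum N (NumberField.discr K)) (ι : K →+* ℂ) (P : (W.baseChange K).toAffine.Point), Summit.BirchSwinnertonDyer.Rank1Residual.Additive.ClassO6 W 3 → W.HasSurjectiveModNGaloisRep 3 → W.analyticRank = 1 → W.conductorNorm ℤ = N → Literature.NumberTheory.EllipticCurves.IsImaginaryQuadratic K → Literature.NumberTheory.EllipticCurves.SatisfiesHeegnerHypothesis N K → (W.quadraticTwist (NumberField.discr K : ℚ)).entireLFunction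 1 ≠ 0 → (WeierstrassCurve.Affine.Point.map ι.toRatAlgHom) P = Literature.NumberTheory.EllipticCurves.ModularForms.heegnerPointComplex Dt H → ¬ IsOfFinAddOrder P → ∀ (κ : Literature.NumberTheory.EllipticCurves.ZpExtension K 3), κ.IsAnticyclotomic → ∀ (γ : Field.absoluteGaloisGroup K) [Fact (κ.IsTopGenerator γ)] (𝔭 : IsDedekindDomain.HeightOneSpectrum (NumberField.RingOfIntegers K)), ((3 : ℕ) : NumberField.RingOfIntegers K) ∈ 𝔭.asIdeal → 𝔭.asIdeal.ramificationIdx (NumberField.RingOfIntegers ℚ) = 1 → 𝔭.asIdeal.inertiaDeg (NumberField.RingOfIntegers ℚ) = 1 → ∀ (𝔭' : IsDedekindDomain.HeightOneSpectrum (NumberField.RingOfIntegers K)), ((3 : ℕ) : NumberField.RingOfIntegers K) ∈ 𝔭'.asIdeal → 𝔭' ≠ 𝔭 → ∀ (ι' : PadicAlgCl 3 ≃+* ℂ), Summit.BirchSwinnertonDyer.BirchSwinnertonDyer.Theorems.SchneiderFree.BranchInducesPrime 3 ι' 𝔭 → ∀ (ΩK : ℂ) (Ωp : ℂ_[3]) (L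 : Literature.NumberTheory.EllipticCurves.UnrSeries 3), ΩK ≠ 0 → Ωp ≠ 0 → Literature.NumberTheory.EllipticCurves.IsBDPLFunction ι' 𝔭 κ γ Dt.f ΩK Ωp L → Module.IsTorsion (Literature.NumberTheory.EllipticCurves.IwasawaAlgebra 3) (Summit.BirchSwinnertonDyer.Rank1Residual.X11b.AcSelmer.XAc (W.baseChange K) 3 κ 𝔭' ∅ γ) → ∀ (f : Literature.NumberTheory.EllipticCurves.IwasawaAlgebra 3), Summit.BirchSwinnertonDyer.Rank1Residual.X11b.AcSelmer.XAc.charIdeal (W.baseChange K) 3 κ 𝔭' ∅ γ = Ideal.span {f} → ‖((PowerSeries.constantCoeff f : ℤ_[3]) : ℚ_[3])‖ ≤ ‖((PowerSeries.constantCoeff L : Literature.NumberTheory.EllipticCurves.unrIntegers 3) : ℂ_[3])‖ := by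
  intro W _ _ N _ K _ _ Dt H ι P hO6 hsurj hr1 hN hK hH hLt hP hnt κ hκ γ _ 𝔭 h𝔭 he hf 𝔭' h𝔭' hne ι' hι ΩK Ωp L hΩK hΩp hL htor f hfI
  have hincl := hE' W N K Dt H ι P hO6 hsurj hr1 hN hK hH hLt hP hnt κ hκ γ 𝔭 h𝔭 he hf 𝔭' h𝔭' hne ι' hι ΩK
    Ωp L hΩK hΩp hL htor
  rw [hfI, CongruenceLimit.map_span_singleton_powerSeries] at hincl
  exact norm_constantCoeff_le_of_map_mem_span 3 ((Ideal.span_singleton_le_iff_mem _).mp hincl)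

/-- **SOED's leaf from the RESTRICTED value-at-𝟙 residual `E_𝟙′`.** `PublishedInputsWildThree → E_𝟙′ →
WildKolyvaginUpperAtThree → WildSplitWaldspurgerAtThree → WildSplitControlAtThree → WildRankZeroTwistAtThree →
WildRankOneSurjNonTowerAtThree → WAllExclAddWildRankOneSurj` — the kernel
`semiOrdinaryEisensteinDescent_eisensteinKernelAtThree_proof` (bed-p3 g1) / w3 g0's
`wAllExclAddWildRankOneSurj_of_valueAtOne` VERBATIM, except that the Eisenstein step is fed by `E_𝟙′`, whose
extra binders `H, ι, P, hLt, hP, hnt` are exactly the Friedberg–Hoffstein / Heegner-point data the kernel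
holds at that point. So the kernel's use of crux E factors through `E′` (indeed through `E_𝟙′`). Every crux is
an antecedent; BSD is not proved by this.
[cite: JetchevSkinnerWan2017, §7.4.1 (arXiv:1512.06894 p. 30)] [cite: Castella2018, Thm. 2.3 and §5 (5.1)–(5.3)]
[cite: GrossZagier1986, Thm. I.(6.3) and V.§2] [cite: FriedbergHoffstein1995, Thm. B] -/
theorem wAllExclAddWildRankOneSurj_of_valueAtOneRestricted (hF : PublishedInputsWildThree)
    (hE1 : ∀ (W : WeierstrassCurve ℚ) [W.IsElliptic] [W.IsGloballyMinimal] (N : ℕ) [NeZero N] (K : Type) [Field K] [NumberField K] (Dt : Literature.NumberTheory.EllipticCurves.ModularForms.ModularParametrizationData W N) (H : Literature.NumberTheory.EllipticCurves.HeegnerDatum N (NumberField.discr K)) (ι : K →+* ℂ) (P : (W.baseChange K).toAffine.Point), Summit.BirchSwinnertonDyer.Rank1Residual.Additive.ClassO6 W 3 → W.HasSurjectiveModNGaloisRep 3 → W.analyticRank = 1 → W.conductorNorm ℤ = N → Literature.NumberTheory.EllipticCurves.IsImaginaryQuadratic K → Literature.NumberTheory.EllipticCurves.SatisfiesHeegnerHypothesis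 N K → (W.quadraticTwist (NumberField.discr K : ℚ)).entireLFunction 1 ≠ 0 → (WeierstrassCurve.Affine.Point.map ι.toRatAlgHom) P = Literature.NumberTheory.EllipticCurves.ModularForms.heegnerPointComplex Dt H → ¬ IsOfFinAddOrder P → ∀ (κ : Literature.NumberTheory.EllipticCurves.ZpExtension K 3), κ.IsAnticyclotomic → ∀ (γ : Field.absoluteGaloisGroup K) [Fact (κ.IsTopGenerator γ)] (𝔭 : IsDedekindDomain.HeightOneSpectrum (NumberField.RingOfIntegers K)), ((3 : ℕ) : NumberField.RingOfIntegers K) ∈ 𝔭.asIdeal → 𝔭.asIdeal.ramificationIdx (NumberField.RingOfIntegers ℚ) = 1 → 𝔭.asIdeal.inertiaDeg (NumberField.RingOfIntegers ℚ) = 1 → ∀ (𝔭' : IsDedekindDomain.HeightOneSpectrum (NumberField.RingOfIntegers K)), ((3 : ℕ) : NumberField.RingOfIntegers K) ∈ 𝔭'.asIdeal → 𝔭' ≠ 𝔭 → ∀ (ι' : PadicAlgCl 3 ≃+* ℂ), Summit.BirchSwinnertonDyer.BirchSwinnertonDyer.Theorems.SchneiderFree.BranchInducesPrime 3 ι' 𝔭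 → ∀ (ΩK : ℂ) (Ωp : ℂ_[3]) (L : Literature.NumberTheory.EllipticCurves.UnrSeries 3), ΩK ≠ 0 → Ωp ≠ 0 → Literature.NumberTheory.EllipticCurves.IsBDPLFunction ι' 𝔭 κ γ Dt.f ΩK Ωp L → Module.IsTorsion (Literature.NumberTheory.EllipticCurves.IwasawaAlgebra 3) (Summit.BirchSwinnertonDyer.Rank1Residual.X11b.AcSelmer.XAc (W.baseChange K) 3 κ 𝔭' ∅ γ) → ∀ (f : Literature.NumberTheory.EllipticCurves.IwasawaAlgebra 3), Summit.BirchSwinnertonDyer.Rank1Residual.X11b.AcSelmer.XAc.charIdeal (W.baseChange K) 3 κ 𝔭' ∅ γ = Ideal.span {f} → ‖((PowerSeries.constantCoeff f : ℤ_[3]) : ℚ_[3])‖ ≤ ‖((PowerSeries.constantCoeff L : Literature.NumberTheory.EllipticCurves.unrIntegers 3) : ℂ_[3])‖)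
    (hKoly : WildKolyvaginUpperAtThree) (hV : WildSplitWaldspurgerAtThree) (hC : WildSplitControlAtThree)
    (hZ : WildRankZeroTwistAtThree) (hNT : WildRankOneSurjNonTowerAtThree) :
    Summit.BirchSwinnertonDyer.WAllExclAddWildRankOneSurj := by
  unfold Summit.BirchSwinnertonDyer.WAllExclAddWildRankOneSurj
  intro W _ _ hncm hO6 hsurj hr
  -- (o) TOWER SPLIT: off the tower-surjective rows the residual crux pays by name
  by_cases htower : AdditiveThree.TowerSurjThree W
  swap
  · exact hNT W hncm hO6 hsurj htower hr
  obtain ⟨hGZ, hKo, hGZK, hmod, hmodP, -, hGZ73, hFH, hpar, hHP⟩ := hF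
  haveI hN0 : NeZero (W.conductorNorm ℤ) := ⟨W.conductorNorm_pos_holds.ne'⟩
  -- (a) DATA. parity: `r_an = 1` is odd, so `w(E) = -1`
  have hw : W.rootNumber = -1 := by
    rcases W.rootNumber_eq_one_or with h | h
    · exfalso
      have heven : Even W.analyticRank := (hpar W).mpr h
      rw [hr] at heven
      exact Nat.not_even_one heven
    · exact h
  -- Friedberg–Hoffstein with auxiliary modulus `2`: Heegner for `N(E)`, `2` split, `L(E^{(d_K)},1) ≠ 0`
  obtain ⟨K, _, _, hK, -, hHN, hH2, hLt⟩ := hFH W hw 2 two_ne_zero 0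
  have hodd : Odd (NumberField.discr K) := by
    have h8 := Literature.SatisfiesHeegnerHypothesis.discr_emod_eight hK.1 hH2 (dvd_refl 2)
    rw [Int.odd_iff]; omega
  -- `3 ∣ N(E)` (additive) splits in `K`; hence `d_K ≠ -3`
  have h3N : 3 ∣ W.conductorNorm ℤ :=
    (W.dvd_conductorNorm_iff_not_hasGoodReductionAtPrime 3).mpr (not_good_of_addv W 3 hO6.2.1)
  have hsplit : SplitsIn K 3 := hHN 3 Nat.prime_three h3N
  have hd3 : NumberField.discr K ≠ -3 := by
    intro h
    exact Literature.SatisfiesHeegnerHypothesis.not_dvd_discr hK.1 hHN Nat.prime_three h3N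
      (by rw [h]; norm_num)
  -- the Heegner point over `K` and its datum; non-torsion by Gross–Zagier
  obtain ⟨P, Dt, H, ι, hP⟩ := hHP W K hK hHN
  have hL0 : W.entireLFunction 1 = 0 := entireLFunction_one_eq_zero_of_analyticRank_eq_one hr
  obtain ⟨-, hderiv⟩ := leadingLCoeff_eq_deriv_of_analyticRank_eq_one hr
  have hLK : LDerivEK W K ≠ 0 := by
    rw [lDerivEK_eq_deriv_mul W K hmod hL0]; exact mul_ne_zero hderiv hLt
  have hnt : ¬ IsOfFinAddOrder P :=
    (lDerivEK_ne_zero_iff_not_isOfFinAddOrder W (W.conductorNorm ℤ) K (hGZ _ W K) hK hHN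
      ⟨Dt, H, ι, hP⟩).mp hLK
  -- Kolyvagin: `rank E(K) = 1`, `Ш(E/K)` finite
  obtain ⟨hrk, hfin⟩ := hKo (W.conductorNorm ℤ) W K hK hHN ⟨Dt, H, ι, hP⟩ hnt
  -- a frame `(κ, γ, 𝔭)` and the other prime `𝔭′ ≠ 𝔭` above `3`
  obtain ⟨κ, γ, -, hκ, hγ, -⟩ := X11b.exists_anticyclotomic_generator_prime (p := 3) hK
  haveI : Fact (κ.IsTopGenerator γ) := ⟨hγ⟩
  obtain ⟨𝔭, h𝔭, he, hf⟩ := X11b.exists_degreeOnePrime_of_splitsIn K 3 hK.1 hsplit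
  obtain ⟨𝔭', hne, h𝔭', he', hf'⟩ := X11b.Three.exists_ne_degreeOne_prime hK.1 h𝔭 he hf
  -- (b) PLUMBING. Waldspurger frame and unit value at `(κ, γ, 𝔭)`
  obtain ⟨ι', hind, ΩK, Ωp, L, hΩK, hΩp, hBDP, u, hval⟩ :=
    hV W (W.conductorNorm ℤ) K Dt H ι P hO6 hsurj hr rfl hK hHN hLt hP hnt κ hκ γ 𝔭 h𝔭 he hf
  -- control count at `𝔭′` (CTL₀ included; supplies the torsion guard of the Eisenstein residual)
  have hctl : SchneiderFree.AdditiveControlOnTreeAt 3 κ 𝔭' γ (embAt K 3 𝔭' h𝔭' he' hf') P :=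
    hC W (W.conductorNorm ℤ) K Dt H ι P hO6 hsurj hr rfl hK hHN hLt hP hnt (hKo _ W K) κ hκ γ 𝔭'
      h𝔭' he' hf'
  obtain ⟨n, hn, hneq⟩ := hctl
  -- the value read through the logarithm at `𝔭′` (rank one: `(log_{𝔭′} P)² = (log_𝔭 P)²`)
  have hval' : L.HasValueAt 0 ((((u : unrIntegers 3) : unrIntegers 3) : ℂ_[3]) *
      (algebraMap ℚ_[3] ℂ_[3]
        (logOmega W 3 (embAt K 3 𝔭' h𝔭' he' hf') P / (Dt.c : ℚ_[3]))) ^ 2) :=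
    (SchneiderFreeAdditiveX3.hasValueAt_sq_logOmega_embAt_iff_of_rank_one W 3 hK.1 hrk h𝔭 he hf
      h𝔭' he' hf' P _ _ L).mpr hval
  -- the LOWER socket at slack `v₃(c)` at the frame `(κ, 𝔭′, γ, embAt 𝔭′)` — from `E_𝟙′`
  have hc0 : Dt.c ≠ 0 := Dt.maninConstant_ne_zero_holds
  have hlog : logOmega W 3 (embAt K 3 𝔭' h𝔭' he' hf') P ≠ 0 := X11b.R1.logOmega_ne_zero W 3 _ hnt
  have hlow : SchneiderFree.AdditiveIMCLowerBDPOnTreeLeAt 3 κ 𝔭' γ (embAt K 3 𝔭' h𝔭' he' hf')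
      (padicValNat 3 Dt.c.natAbs) P := by
    obtain ⟨htors, f, hfI, hf0, hfn⟩ := hn
    -- `E_𝟙′` at the frame, WITH the datum the kernel holds here: `‖f(𝟙)‖₃ ≤ ‖L(𝟙)‖`
    have hle1 : ‖((constantCoeff f : ℤ_[3]) : ℚ_[3])‖ ≤ ‖((constantCoeff L : unrIntegers 3) : ℂ_[3])‖ :=
      hE1 W (W.conductorNorm ℤ) K Dt H ι P hO6 hsurj hr rfl hK hHN hLt hP hnt κ hκ γ 𝔭 h𝔭 he hf 𝔭' h𝔭'
        hne ι' hind ΩK Ωp L hΩK hΩp hBDP htors f hfI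
    obtain ⟨-, hle⟩ := two_mul_valuation_le_of_norm_constantCoeff_le 3 hf0 hle1 u hval'
    have hc0' : (Dt.c : ℚ_[3]) ≠ 0 := by exact_mod_cast hc0
    rw [div_eq_mul_inv, Padic.valuation_mul hlog (inv_ne_zero hc0'), Padic.valuation_inv,
      Padic.valuation_intCast, valuation_logOmega hlog, hfn] at hle
    refine ⟨n, ⟨htors, f, hfI, hf0, hfn⟩, ?_⟩
    simp only [padicValInt] at hle
    linarith
  have hlo : SchneiderFree.IndexLowerBoundLeAt W 3 K P (padicValNat 3 Dt.c.natAbs) :=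
    SchneiderFreeAdditiveX3.indexLowerBoundLeAt_of_imcLowerLe_of_control rfl hK hHN hfin hlow
      ⟨n, hn, hneq⟩
  -- the UPPER socket at slack `v₃(c)` IS the Kolyvagin crux (tower surjectivity, `d_K` odd, `≠ -3`)
  have hupI : SchneiderFree.Upper.IndexUpperBoundLeAt W 3 K P (padicValNat 3 Dt.c.natAbs) :=
    hKoly W (W.conductorNorm ℤ) K Dt H ι P hO6 hsurj hr rfl hK hHN hLt hP hnt hodd hd3 htower
  -- (c) TERMINAL STEP: a globally minimal model of the twist, then p528981
  have hD0 : (NumberField.discr K : ℚ) ≠ 0 := by exact_mod_cast NumberField.discr_ne_zero K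
  haveI : (W.quadraticTwist (NumberField.discr K : ℚ)).IsElliptic := W.isElliptic_quadraticTwist hD0
  obtain ⟨Cd, hCd⟩ := hasGlobalMinimalModel_rat_holds (W.quadraticTwist (NumberField.discr K : ℚ))
  haveI : (Cd • W.quadraticTwist (NumberField.discr K : ℚ)).IsGloballyMinimal := hCd
  exact SchneiderFree.Exact.bsdp_three_of_exactIndexManin_of_wAllExclAddWildRankZero hGZ hKo hGZK hmod
    hGZ73 hZ W hO6 hsurj hr (W.conductorNorm ℤ) K Dt H ι P
    (Cd • W.quadraticTwist (NumberField.discr K : ℚ)) rfl hK hodd hHN hLt hP ⟨Cd, rfl⟩ hlo hupI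

/-- **SOED's leaf from the RESTRICTED crux `E′`** (with §3 `valueAtOneRestricted_of_restricted`): the kernel's
chain `PublishedInputsWildThree → E′ → WildKolyvaginUpperAtThree → WildSplitWaldspurgerAtThree →
WildSplitControlAtThree → WildRankZeroTwistAtThree → WildRankOneSurjNonTowerAtThree → WAllExclAddWildRankOneSurj`
— a certified closer for a route edit «#2 ↦ E′» (every crux an antecedent; BSD is not proved by this).
[cite: JetchevSkinnerWan2017, §7.4.1 (arXiv:1512.06894 p. 30)] -/
theorem wAllExclAddWildRankOneSurj_of_restricted (hF : PublishedInputsWildThree)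
    (hE' : ∀ (W : WeierstrassCurve ℚ) [W.IsElliptic] [W.IsGloballyMinimal] (N : ℕ) [NeZero N] (K : Type) [Field K] [NumberField K] (Dt : Literature.NumberTheory.EllipticCurves.ModularForms.ModularParametrizationData W N) (H : Literature.NumberTheory.EllipticCurves.HeegnerDatum N (NumberField.discr K)) (ι : K →+* ℂ) (P : (W.baseChange K).toAffine.Point), Summit.BirchSwinnertonDyer.Rank1Residual.Additive.ClassO6 W 3 → W.HasSurjectiveModNGaloisRep 3 → W.analyticRank = 1 → W.conductorNorm ℤ = N → Literature.NumberTheory.EllipticCurves.IsImaginaryQuadratic K → Literature.NumberTheory.EllipticCurves.SatisfiesHeegnerHypothesis N K → (W.quadraticTwist (NumberField.discr K : ℚ)).entireLFunction 1 ≠ 0 → (WeierstrassCurve.Affine.Point.map ι.toRatAlgHom) P = Literature.NumberTheory.EllipticCurves.ModularForms.heegnerPointComplex Dt H → ¬ IsOfFinAddOrder P → ∀ (κ : Literature.NumberTheory.EllipticCurves.ZpExtension K 3), κ.IsAnticyclotomic → ∀ (γ : Field.absoluteGaloisGroup K) [Fact (κ.IsTopGenerator γ)] (𝔭 : IsDedekindDomain.HeightOneSpectrum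 (NumberField.RingOfIntegers K)), ((3 : ℕ) : NumberField.RingOfIntegers K) ∈ 𝔭.asIdeal → 𝔭.asIdeal.ramificationIdx (NumberField.RingOfIntegers ℚ) = 1 → 𝔭.asIdeal.inertiaDeg (NumberField.RingOfIntegers ℚ) = 1 → ∀ (𝔭' : IsDedekindDomain.HeightOneSpectrum (NumberField.RingOfIntegers K)), ((3 : ℕ) : NumberField.RingOfIntegers K) ∈ 𝔭'.asIdeal → 𝔭' ≠ 𝔭 → ∀ (ι' : PadicAlgCl 3 ≃+* ℂ), Summit.BirchSwinnertonDyer.BirchSwinnertonDyer.Theorems.SchneiderFree.BranchInducesPrime 3 ι' 𝔭 → ∀ (ΩK : ℂ) (Ωp : ℂ_[3]) (L : Literature.NumberTheory.EllipticCurves.UnrSeries 3), ΩK ≠ 0 → Ωp ≠ 0 → Literature.NumberTheory.EllipticCurves.IsBDPLFunction ι' 𝔭 κ γ Dt.f ΩK Ωp L → Module.IsTorsion (Literature.NumberTheory.EllipticCurves.IwasawaAlgebra 3) (Summit.BirchSwinnertonDyer.Rank1Residual.X11b.AcSelmer.XAc (W.baseChange K) 3 κ 𝔭' ∅ γ) →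 (Summit.BirchSwinnertonDyer.Rank1Residual.X11b.AcSelmer.XAc.charIdeal (W.baseChange K) 3 κ 𝔭' ∅ γ).map (PowerSeries.map (Summit.BirchSwinnertonDyer.Rank1Residual.X11b.Halves.toUnr 3)) ≤ Ideal.span {L})
    (hKoly : WildKolyvaginUpperAtThree) (hV : WildSplitWaldspurgerAtThree) (hC : WildSplitControlAtThree)
    (hZ : WildRankZeroTwistAtThree) (hNT : WildRankOneSurjNonTowerAtThree) :
    Summit.BirchSwinnertonDyer.WAllExclAddWildRankOneSurj :=
  wAllExclAddWildRankOneSurj_of_valueAtOneRestricted hF (valueAtOneRestricted_of_restricted hE') hKoly hV hC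
    hZ hNT

/-! ### §4 `E′ ⟸` the Kolyvagin inclusion + the restricted value-at-𝟙 residual + control -/

/-- **`E′` from UTD's Kolyvagin inclusion, `E_𝟙′` and the shared control crux.** Hypotheses: Kolyvagin's
finiteness BY NAME (the antecedent crux #5 carries); `hKo` = the signature of route UTD's crux
`AdditiveSplitIMCInclusionAtThree` (stmt-BirchSwinnertonDyer-20395) VERBATIM, displayed (that route's file is
not imported): every frame `L` lies in `Ch_Λ(X_(∅,0))·R₀⟦T⟧`; `hE1` = the restricted value-at-𝟙 residual
`E_𝟙′`; `hC` = crux #5 `WildSplitControlAtThree` (at the strict place `𝔭′`, of degree one because `3 ∣ N`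
splits in the Heegner field — `X11b.degreeOne_of_splitsIn`; it supplies a generator `f` with `f(𝟙) ≠ 0`).
Conclusion: `E′`, by §1 `span_map_le_span_of_span_le_of_norm_le` at each instance. READING: over
{Kolyvagin, UTD 20395, control} the Λ-adic restricted Eisenstein inclusion is NOT stronger than its `T = 0`
shadow. Nothing is asserted about any hypothesis. [cite: JetchevSkinnerWan2017, Thm. 3.3.1 and §7.4.1]
[cite: SerreLocalFields1979, Ch. IV §4, Prop. 16] -/
theorem restricted_of_kolyvaginInclusion_of_valueAtOneRestricted_of_control
    (hKv : ∀ (N : ℕ) [NeZero N] (W : WeierstrassCurve ℚ) (K : Type) [Field K] [NumberField K], Literature.NumberTheory.EllipticCurves.kolyvagin N W K)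
    (hKo : ∀ (W : WeierstrassCurve ℚ) [W.IsElliptic] [W.IsGloballyMinimal] (N : ℕ) [NeZero N] (K : Type) [Field K] [NumberField K] (Dt : Literature.NumberTheory.EllipticCurves.ModularForms.ModularParametrizationData W N), Summit.BirchSwinnertonDyer.Rank1Residual.Additive.ClassO6 W 3 → W.HasSurjectiveModNGaloisRep 3 → W.analyticRank = 1 → W.conductorNorm ℤ = N → Literature.NumberTheory.EllipticCurves.IsImaginaryQuadratic K → Literature.NumberTheory.EllipticCurves.SatisfiesHeegnerHypothesis N K → ∀ (κ : Literature.NumberTheory.EllipticCurves.ZpExtension K 3), κ.IsAnticyclotomic → ∀ (γ : Field.absoluteGaloisGroup K) [Fact (κ.IsTopGenerator γ)] (𝔭 : IsDedekindDomain.HeightOneSpectrum (NumberField.RingOfIntegers K)), ((3 : ℕ) : NumberField.RingOfIntegers K) ∈ 𝔭.asIdeal → 𝔭.asIdeal.ramificationIdx (NumberField.RingOfIntegers ℚ) = 1 → 𝔭.asIdeal.inertiaDeg (NumberField.RingOfIntegers ℚ) = 1 → ∀ (𝔭' : IsDedekindDomain.HeightOneSpectrum (NumberField.RingOfIntegers K)),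 ((3 : ℕ) : NumberField.RingOfIntegers K) ∈ 𝔭'.asIdeal → 𝔭' ≠ 𝔭 → ∀ (ι' : PadicAlgCl 3 ≃+* ℂ), Summit.BirchSwinnertonDyer.BirchSwinnertonDyer.Theorems.SchneiderFree.BranchInducesPrime 3 ι' 𝔭 → ∀ (ΩK : ℂ) (Ωp : ℂ_[3]) (L : Literature.NumberTheory.EllipticCurves.UnrSeries 3), ΩK ≠ 0 → Ωp ≠ 0 → Literature.NumberTheory.EllipticCurves.IsBDPLFunction ι' 𝔭 κ γ Dt.f ΩK Ωp L → Ideal.span {L} ≤ (Summit.BirchSwinnertonDyer.Rank1Residual.X11b.AcSelmer.XAc.charIdeal (W.baseChange K) 3 κ 𝔭' ∅ γ).map (PowerSeries.map (Summit.BirchSwinnertonDyer.Rank1Residual.X11b.Halves.toUnr 3)))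
    (hE1 : ∀ (W : WeierstrassCurve ℚ) [W.IsElliptic] [W.IsGloballyMinimal] (N : ℕ) [NeZero N] (K : Type) [Field K] [NumberField K] (Dt : Literature.NumberTheory.EllipticCurves.ModularForms.ModularParametrizationData W N) (H : Literature.NumberTheory.EllipticCurves.HeegnerDatum N (NumberField.discr K)) (ι : K →+* ℂ) (P : (W.baseChange K).toAffine.Point), Summit.BirchSwinnertonDyer.Rank1Residual.Additive.ClassO6 W 3 → W.HasSurjectiveModNGaloisRep 3 → W.analyticRank = 1 → W.conductorNorm ℤ = N → Literature.NumberTheory.EllipticCurves.IsImaginaryQuadratic K → Literature.NumberTheory.EllipticCurves.SatisfiesHeegnerHypothesis N K → (W.quadraticTwist (NumberField.discr K : ℚ)).entireLFunction 1 ≠ 0 → (WeierstrassCurve.Affine.Point.map ι.toRatAlgHom) P = Literature.NumberTheory.EllipticCurves.ModularForms.heegnerPointComplex Dt H → ¬ IsOfFinAddOrder P → ∀ (κ : Literature.NumberTheory.EllipticCurves.ZpExtension K 3), κ.IsAnticyclotomic → ∀ (γ : Field.absoluteGaloisGroup K) [Fact (κ.IsTopGenerator γ)] (𝔭 : IsDedekindDomain.HeightOneSpectrum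 (NumberField.RingOfIntegers K)), ((3 : ℕ) : NumberField.RingOfIntegers K) ∈ 𝔭.asIdeal → 𝔭.asIdeal.ramificationIdx (NumberField.RingOfIntegers ℚ) = 1 → 𝔭.asIdeal.inertiaDeg (NumberField.RingOfIntegers ℚ) = 1 → ∀ (𝔭' : IsDedekindDomain.HeightOneSpectrum (NumberField.RingOfIntegers K)), ((3 : ℕ) : NumberField.RingOfIntegers K) ∈ 𝔭'.asIdeal → 𝔭' ≠ 𝔭 → ∀ (ι' : PadicAlgCl 3 ≃+* ℂ), Summit.BirchSwinnertonDyer.BirchSwinnertonDyer.Theorems.SchneiderFree.BranchInducesPrime 3 ι' 𝔭 → ∀ (ΩK : ℂ) (Ωp : ℂ_[3]) (L : Literature.NumberTheory.EllipticCurves.UnrSeries 3), ΩK ≠ 0 → Ωp ≠ 0 → Literature.NumberTheory.EllipticCurves.IsBDPLFunction ι' 𝔭 κ γ Dt.f ΩK Ωp L → Module.IsTorsion (Literature.NumberTheory.EllipticCurves.IwasawaAlgebra 3) (Summit.BirchSwinnertonDyer.Rank1Residual.X11b.AcSelmer.XAc (W.baseChange K) 3 κ 𝔭' ∅ γ) →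 ∀ (f : Literature.NumberTheory.EllipticCurves.IwasawaAlgebra 3), Summit.BirchSwinnertonDyer.Rank1Residual.X11b.AcSelmer.XAc.charIdeal (W.baseChange K) 3 κ 𝔭' ∅ γ = Ideal.span {f} → ‖((PowerSeries.constantCoeff f : ℤ_[3]) : ℚ_[3])‖ ≤ ‖((PowerSeries.constantCoeff L : Literature.NumberTheory.EllipticCurves.unrIntegers 3) : ℂ_[3])‖)
    (hC : WildSplitControlAtThree) :
    ∀ (W : WeierstrassCurve ℚ) [W.IsElliptic] [W.IsGloballyMinimal] (N : ℕ) [NeZero N] (K : Type) [Field K] [NumberField K] (Dt : Literature.NumberTheory.EllipticCurves.ModularForms.ModularParametrizationData W N) (H : Literature.NumberTheory.EllipticCurves.HeegnerDatum N (NumberField.discr K)) (ι : K →+* ℂ) (P : (W.baseChange K).toAffine.Point), Summit.BirchSwinnertonDyer.Rank1Residual.Additive.ClassO6 W 3 → W.HasSurjectiveModNGaloisRep 3 → W.analyticRank = 1 → W.conductorNorm ℤ = N → Literature.NumberTheory.EllipticCurves.IsImaginaryQuadratic K → Literature.NumberTheory.EllipticCurves.SatisfiesHeegnerHypothesis N K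 → (W.quadraticTwist (NumberField.discr K : ℚ)).entireLFunction 1 ≠ 0 → (WeierstrassCurve.Affine.Point.map ι.toRatAlgHom) P = Literature.NumberTheory.EllipticCurves.ModularForms.heegnerPointComplex Dt H → ¬ IsOfFinAddOrder P → ∀ (κ : Literature.NumberTheory.EllipticCurves.ZpExtension K 3), κ.IsAnticyclotomic → ∀ (γ : Field.absoluteGaloisGroup K) [Fact (κ.IsTopGenerator γ)] (𝔭 : IsDedekindDomain.HeightOneSpectrum (NumberField.RingOfIntegers K)), ((3 : ℕ) : NumberField.RingOfIntegers K) ∈ 𝔭.asIdeal → 𝔭.asIdeal.ramificationIdx (NumberField.RingOfIntegers ℚ) = 1 → 𝔭.asIdeal.inertiaDeg (NumberField.RingOfIntegers ℚ) = 1 → ∀ (𝔭' : IsDedekindDomain.HeightOneSpectrum (NumberField.RingOfIntegers K)), ((3 : ℕ) : NumberField.RingOfIntegers K) ∈ 𝔭'.asIdeal → 𝔭' ≠ 𝔭 → ∀ (ι' : PadicAlgCl 3 ≃+* ℂ), Summit.BirchSwinnertonDyer.BirchSwinnertonDyer.Theorems.SchneiderFree.BranchInducesPrime 3 ι' 𝔭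 → ∀ (ΩK : ℂ) (Ωp : ℂ_[3]) (L : Literature.NumberTheory.EllipticCurves.UnrSeries 3), ΩK ≠ 0 → Ωp ≠ 0 → Literature.NumberTheory.EllipticCurves.IsBDPLFunction ι' 𝔭 κ γ Dt.f ΩK Ωp L → Module.IsTorsion (Literature.NumberTheory.EllipticCurves.IwasawaAlgebra 3) (Summit.BirchSwinnertonDyer.Rank1Residual.X11b.AcSelmer.XAc (W.baseChange K) 3 κ 𝔭' ∅ γ) → (Summit.BirchSwinnertonDyer.Rank1Residual.X11b.AcSelmer.XAc.charIdeal (W.baseChange K) 3 κ 𝔭' ∅ γ).map (PowerSeries.map (Summit.BirchSwinnertonDyer.Rank1Residual.X11b.Halves.toUnr 3)) ≤ Ideal.span {L} := by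
  intro W _ _ N _ K _ _ Dt H ι P hO6 hsurj hr1 hN hK hH hLt hP hnt κ hκ γ _ 𝔭 h𝔭 he hf 𝔭' h𝔭' hne ι' hι ΩK Ωp L hΩK hΩp hL htor
  -- `𝔭′ ∋ 3` is of degree one: `3 ∣ N` (additive) splits in the Heegner field `K`
  have h3N : 3 ∣ N :=
    hN ▸ (W.dvd_conductorNorm_iff_not_hasGoodReductionAtPrime 3).mpr (not_good_of_addv W 3 hO6.2.1)
  obtain ⟨he', hf'⟩ := X11b.degreeOne_of_splitsIn (p := 3) hK.1 (hH 3 Nat.prime_three h3N) h𝔭'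
  -- control at `𝔭′`: a generator `f` of `Ch_Λ(X_(∅,0))` with `f(𝟙) ≠ 0`
  obtain ⟨n, ⟨-, f, hfI, hf0, -⟩, -⟩ :=
    hC W N K Dt H ι P hO6 hsurj hr1 hN hK hH hLt hP hnt (hKv N W K) κ hκ γ 𝔭' h𝔭' he' hf'
  -- the Kolyvagin inclusion and the value-at-𝟙 residual at this frame
  have hko := hKo W N K Dt hO6 hsurj hr1 hN hK hH κ hκ γ 𝔭 h𝔭 he hf 𝔭' h𝔭' hne ι' hι ΩK Ωp L hΩK hΩp hL
  have hle1 := hE1 W N K Dt H ι P hO6 hsurj hr1 hN hK hH hLt hP hnt κ hκ γ 𝔭 h𝔭 he hf 𝔭' h𝔭' hne ι' hι ΩK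
    Ωp L hΩK hΩp hL htor f hfI
  rw [hfI, CongruenceLimit.map_span_singleton_powerSeries] at hko ⊢
  exact span_map_le_span_of_span_le_of_norm_le 3 hko hf0 hle1

/-- **Over {Kolyvagin, UTD 20395, control}: `E′ ⟺ E_𝟙′`** — the restricted Λ-adic Eisenstein inclusion and
its value-at-𝟙 shadow are EQUIVALENT (§3 `valueAtOneRestricted_of_restricted`, §4
`restricted_of_kolyvaginInclusion_of_valueAtOneRestricted_of_control`). Planning reading for the pen's option
«swap E for `E_𝟙`» (w3 g0): modulo UTD's 20395 and crux #5 the swap neither loses nor gains anything on the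
rank-one instances the kernel uses. [folklore] -/
theorem restricted_iff_valueAtOneRestricted
    (hKv : ∀ (N : ℕ) [NeZero N] (W : WeierstrassCurve ℚ) (K : Type) [Field K] [NumberField K], Literature.NumberTheory.EllipticCurves.kolyvagin N W K)
    (hKo : ∀ (W : WeierstrassCurve ℚ) [W.IsElliptic] [W.IsGloballyMinimal] (N : ℕ) [NeZero N] (K : Type) [Field K] [NumberField K] (Dt : Literature.NumberTheory.EllipticCurves.ModularForms.ModularParametrizationData W N), Summit.BirchSwinnertonDyer.Rank1Residual.Additive.ClassO6 W 3 → W.HasSurjectiveModNGaloisRep 3 → W.analyticRank = 1 → W.conductorNorm ℤ = N → Literature.NumberTheory.EllipticCurves.IsImaginaryQuadratic K → Literature.NumberTheory.EllipticCurves.SatisfiesHeegnerHypothesis N K → ∀ (κ : Literature.NumberTheory.EllipticCurves.ZpExtension K 3), κ.IsAnticyclotomic → ∀ (γ : Field.absoluteGaloisGroup K) [Fact (κ.IsTopGenerator γ)] (𝔭 : IsDedekindDomain.HeightOneSpectrum (NumberField.RingOfIntegers K)), ((3 : ℕ) : NumberField.RingOfIntegers K) ∈ 𝔭.asIdeal →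 𝔭.asIdeal.ramificationIdx (NumberField.RingOfIntegers ℚ) = 1 → 𝔭.asIdeal.inertiaDeg (NumberField.RingOfIntegers ℚ) = 1 → ∀ (𝔭' : IsDedekindDomain.HeightOneSpectrum (NumberField.RingOfIntegers K)), ((3 : ℕ) : NumberField.RingOfIntegers K) ∈ 𝔭'.asIdeal → 𝔭' ≠ 𝔭 → ∀ (ι' : PadicAlgCl 3 ≃+* ℂ), Summit.BirchSwinnertonDyer.BirchSwinnertonDyer.Theorems.SchneiderFree.BranchInducesPrime 3 ι' 𝔭 → ∀ (ΩK : ℂ) (Ωp : ℂ_[3]) (L : Literature.NumberTheory.EllipticCurves.UnrSeries 3), ΩK ≠ 0 → Ωp ≠ 0 → Literature.NumberTheory.EllipticCurves.IsBDPLFunction ι' 𝔭 κ γ Dt.f ΩK Ωp L → Ideal.span {L} ≤ (Summit.BirchSwinnertonDyer.Rank1Residual.X11b.AcSelmer.XAc.charIdeal (W.baseChange K) 3 κ 𝔭' ∅ γ).map (PowerSeries.map (Summit.BirchSwinnertonDyer.Rank1Residual.X11b.Halves.toUnr 3)))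
    (hC : WildSplitControlAtThree) :
    (∀ (W : WeierstrassCurve ℚ) [W.IsElliptic] [W.IsGloballyMinimal] (N : ℕ) [NeZero N] (K : Type) [Field K] [NumberField K] (Dt : Literature.NumberTheory.EllipticCurves.ModularForms.ModularParametrizationData W N) (H : Literature.NumberTheory.EllipticCurves.HeegnerDatum N (NumberField.discr K)) (ι : K →+* ℂ) (P : (W.baseChange K).toAffine.Point), Summit.BirchSwinnertonDyer.Rank1Residual.Additive.ClassO6 W 3 → W.HasSurjectiveModNGaloisRep 3 → W.analyticRank = 1 → W.conductorNorm ℤ = N → Literature.NumberTheory.EllipticCurves.IsImaginaryQuadratic K → Literature.NumberTheory.EllipticCurves.SatisfiesHeegnerHypothesis N K → (W.quadraticTwist (NumberField.discr K : ℚ)).entireLFunction 1 ≠ 0 → (WeierstrassCurve.Affine.Point.map ι.toRatAlgHom) P = Literature.NumberTheory.EllipticCurves.ModularForms.heegnerPointComplex Dt H → ¬ IsOfFinAddOrder P → ∀ (κ : Literature.NumberTheory.EllipticCurves.ZpExtension K 3), κ.IsAnticyclotomic → ∀ (γ : Field.absoluteGaloisGroup K) [Fact (κ.IsTopGenerator γ)]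 (𝔭 : IsDedekindDomain.HeightOneSpectrum (NumberField.RingOfIntegers K)), ((3 : ℕ) : NumberField.RingOfIntegers K) ∈ 𝔭.asIdeal → 𝔭.asIdeal.ramificationIdx (NumberField.RingOfIntegers ℚ) = 1 → 𝔭.asIdeal.inertiaDeg (NumberField.RingOfIntegers ℚ) = 1 → ∀ (𝔭' : IsDedekindDomain.HeightOneSpectrum (NumberField.RingOfIntegers K)), ((3 : ℕ) : NumberField.RingOfIntegers K) ∈ 𝔭'.asIdeal → 𝔭' ≠ 𝔭 → ∀ (ι' : PadicAlgCl 3 ≃+* ℂ), Summit.BirchSwinnertonDyer.BirchSwinnertonDyer.Theorems.SchneiderFree.BranchInducesPrime 3 ι' 𝔭 → ∀ (ΩK : ℂ) (Ωp : ℂ_[3]) (L : Literature.NumberTheory.EllipticCurves.UnrSeries 3), ΩK ≠ 0 → Ωp ≠ 0 → Literature.NumberTheory.EllipticCurves.IsBDPLFunction ι' 𝔭 κ γ Dt.f ΩK Ωp L → Module.IsTorsion (Literature.NumberTheory.EllipticCurves.IwasawaAlgebra 3) (Summit.BirchSwinnertonDyer.Rank1Residual.X11b.AcSelmer.XAc (W.baseChange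 K) 3 κ 𝔭' ∅ γ) → (Summit.BirchSwinnertonDyer.Rank1Residual.X11b.AcSelmer.XAc.charIdeal (W.baseChange K) 3 κ 𝔭' ∅ γ).map (PowerSeries.map (Summit.BirchSwinnertonDyer.Rank1Residual.X11b.Halves.toUnr 3)) ≤ Ideal.span {L}) ↔
      (∀ (W : WeierstrassCurve ℚ) [W.IsElliptic] [W.IsGloballyMinimal] (N : ℕ) [NeZero N] (K : Type) [Field K] [NumberField K] (Dt : Literature.NumberTheory.EllipticCurves.ModularForms.ModularParametrizationData W N) (H : Literature.NumberTheory.EllipticCurves.HeegnerDatum N (NumberField.discr K)) (ι : K →+* ℂ) (P : (W.baseChange K).toAffine.Point), Summit.BirchSwinnertonDyer.Rank1Residual.Additive.ClassO6 W 3 → W.HasSurjectiveModNGaloisRep 3 → W.analyticRank = 1 → W.conductorNorm ℤ = N → Literature.NumberTheory.EllipticCurves.IsImaginaryQuadratic K → Literature.NumberTheory.EllipticCurves.SatisfiesHeegnerHypothesis N K → (W.quadraticTwist (NumberField.discr K : ℚ)).entireLFunction 1 ≠ 0 → (WeierstrassCurve.Affine.Point.map ι.toRatAlgHom) P = Literature.NumberTheory.EllipticCurves.ModularForms.heegnerPointComplex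 Dt H → ¬ IsOfFinAddOrder P → ∀ (κ : Literature.NumberTheory.EllipticCurves.ZpExtension K 3), κ.IsAnticyclotomic → ∀ (γ : Field.absoluteGaloisGroup K) [Fact (κ.IsTopGenerator γ)] (𝔭 : IsDedekindDomain.HeightOneSpectrum (NumberField.RingOfIntegers K)), ((3 : ℕ) : NumberField.RingOfIntegers K) ∈ 𝔭.asIdeal → 𝔭.asIdeal.ramificationIdx (NumberField.RingOfIntegers ℚ) = 1 → 𝔭.asIdeal.inertiaDeg (NumberField.RingOfIntegers ℚ) = 1 → ∀ (𝔭' : IsDedekindDomain.HeightOneSpectrum (NumberField.RingOfIntegers K)), ((3 : ℕ) : NumberField.RingOfIntegers K) ∈ 𝔭'.asIdeal → 𝔭' ≠ 𝔭 → ∀ (ι' : PadicAlgCl 3 ≃+* ℂ), Summit.BirchSwinnertonDyer.BirchSwinnertonDyer.Theorems.SchneiderFree.BranchInducesPrime 3 ι' 𝔭 → ∀ (ΩK : ℂ) (Ωp : ℂ_[3]) (L : Literature.NumberTheory.EllipticCurves.UnrSeries 3), ΩK ≠ 0 → Ωp ≠ 0 → Literature.NumberTheory.EllipticCurves.IsBDPLFunction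 ι' 𝔭 κ γ Dt.f ΩK Ωp L → Module.IsTorsion (Literature.NumberTheory.EllipticCurves.IwasawaAlgebra 3) (Summit.BirchSwinnertonDyer.Rank1Residual.X11b.AcSelmer.XAc (W.baseChange K) 3 κ 𝔭' ∅ γ) → ∀ (f : Literature.NumberTheory.EllipticCurves.IwasawaAlgebra 3), Summit.BirchSwinnertonDyer.Rank1Residual.X11b.AcSelmer.XAc.charIdeal (W.baseChange K) 3 κ 𝔭' ∅ γ = Ideal.span {f} → ‖((PowerSeries.constantCoeff f : ℤ_[3]) : ℚ_[3])‖ ≤ ‖((PowerSeries.constantCoeff L : Literature.NumberTheory.EllipticCurves.unrIntegers 3) : ℂ_[3])‖) :=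
  ⟨valueAtOneRestricted_of_restricted,
    fun hE1 ↦ restricted_of_kolyvaginInclusion_of_valueAtOneRestricted_of_control hKv hKo hE1 hC⟩

end Summit.BirchSwinnertonDyer.BirchSwinnertonDyer.Theorems.WildSplitEisensteinInclusionAtThreeRankOneRestriction

end
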